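import Summits.QuantumFields.YangMills.Theorems.BalabanLadderUVOtherGroupsClasses
import Summits.QuantumFields.YangMills.Theorems.BalabanLadderUVSeamRecFloorsEngineOfWindow
import Summits.QuantumFields.YangMills.Theorems.LangevinControlUVOSLegsFromFemtoAndGapStubLower
import Literature.MathematicalPhysics.QuantumLattice.RepLieAlgebraUnitary
import HarnessLib

/-!
# Route `BalabanLadder`, crux `UVOtherGroups` (stmt-QuantumFields-19356): the witness-currency pieces from the femto package AT ITS OWN UNIT

Helper file (`--supports stmt-QuantumFields-19356`, fleet seat `ym-osasm-p2`, director-ym R136 (iii)); pure theorems.  The route owner's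
R85 cut of the residual class (ym-beyond-p2 g20, 2026-08-26) is in WITNESS currency for every class beyond `SU(2)`: `UVSeamWitnessSUN`
(`Theorems/BalabanLadderUVOtherGroupsDefs.lean` §3: for `N ≥ 3`, apex at `SU(N)` ⇒ SOME `(r, a)` carries floors ∧ ceilings) and the
non-`SU(N)` record residual (SOME `(r, a)` per group).  This file records what feeds such pieces at the resolution of the tree's femto-cube
vocabulary (`Theorems/LangevinControlUVOSLegsFromFemtoAndGapDefs.lean`: the plane-resolved frozen-boundary law `FBL6`, the conditional
two-point ∕ third-cumulant floors `FC2`, `FC3` — the «CFP6 package» — and the femto packages `TwoPointPinned`, `Skewness`), using only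
LANDED generic theorems: `DlrCollarTransfer.stub_lower` (`FBL ∧ FC2 ∧ FC3 ⇒ LowerBounds`, same unit), `DlrCollarTransfer.stub_collar6`
(`FBL6 ⇒ MomentBounds6`, same unit), `fbl_of_fbl6`, `UVSeamRec.CeilingsTransfer.fbl6_of_eventually_le`.

THE POINT (kernel-checked): in witness currency the femto package feeds the legs AT ITS OWN UNIT — `legs_of_cfp6` — so NONE of the unit
bookkeeping the spine's pinned-unit item `UVSeamRec` needs (unit of record `uRec`, two-loop commensurability F-C, window transfer, unit
dilation, ratio convergence: `Theorems/BalabanLadderUVSeamRec{UnitTransfer,WindowTransfer,UnitDilation,FloorsEngineOfWindow,…}.lean`) arises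
for `UVSeamWitnessSUN` or for the record residual; and no `N`-generic unit of record has to be typed (the seat's repair census (C) of
`FINDING-19356-SUN-split.md` is thereby moot for the adopted shape, as the owner ruled).

* §1 generic `G`: `legs_of_cfp6`, `legsWitness_of_cfp6`; `legs_of_ceilings6_engine` (FBL6 at a FINER unit `u ≤ c · a` — Bałaban's own —
  plus the engine's `FC2 ∧ FC3` at `a`); `legs_of_femto6` (through the OPEN engine-grade stub `Statement.stub_fcp6` of crux
  stmt-QuantumFields-9367: `TwoPointPinned ∧ Skewness ⇒ FBL6 ∧ FC2 ∧ FC3`).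
* §2 the `SU(N ≥ 3)` piece: `uvSeamWitnessSUN_of_cfp6` (any representation), `uvSeamWitnessSUN_of_ceilings6_engine_fundamental` (at the
  FUNDAMENTAL representation `fundamentalLatticeRep N` — the representation of Bałaban's Wilson action — with E0′ read as «apex ⇒ `FBL6` at
  Bałaban's unit»), `uvSeamWitnessSUN_of_femto6`.
* §3 the non-`SU(N)` record piece: `nonSUNRec_of_cfp6`, `nonSUNRec_of_femto6`.
* §4 all groups: `legsWitnessAll_of_cfp6All`, `legsWitnessAll_of_femto6All`, and the bridge fed this way, `yangMills_of_cfp6All_rotIR`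
  (CFP6 for every compact simple `G` + `IR` + `ROT` rev 2 ⊢ `YangMills`) — the identity check that the femto feed and the apex feed
  (`yangMills_of_recordSplit_rotIR`) land in the SAME bridge input.

HONEST FRAMING: every hypothesis here is OPEN and XL per group — `FBL6` is an ultraviolet-stability statement uniform in the exterior field
(barrier `Literature.Barriers.QuantumFields.UVStabilityNonUniqueness`), `FC2`/`FC3` are β-uniform non-triviality floors (barrier
`PerturbativeInvisibility`, dimensional transmutation), `Statement.stub_fcp6` is the unlanded engine stub of crux 9367; the apex hypothesis
`UVD59 N` of `UVSeamWitnessSUN` is not USED by any feed below (it is the KEY under which E0′ is expected to deliver `FBL6`, nothing more).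
Composition only; nothing is discharged; not a gap, not Clay.
-/

set_option autoImplicit false

noncomputable section

open MeasureTheory Filter Topology
open Literature.MathematicalPhysics.QuantumFieldTheory Literature.MathematicalPhysics.QuantumLattice
open Summit.QuantumFields.YangMills.Cruxes.OSLegsFromFemtoAndGap.DlrCollarTransfer
open Summit.QuantumFields.YangMills.Cruxes.UVSeamRec.Transport
open Summit.QuantumFields.YangMills.Cruxes.OSLegsAtWeakCouplingC.Y2Bridge (LatticeRotWard yangMills_of_legs)

namespace Summit.QuantumFields.YangMills.Theorems.UVOtherGroups

/-! ## §1 Generic compact `G`: legs from the femto package at its own unit -/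

section Generic

variable {G : Type} [Group G] [TopologicalSpace G] [IsTopologicalGroup G] [CompactSpace G]
  [MeasurableSpace G] [BorelSpace G]

/-- **Both legs from the CFP6 package AT THE SAME UNIT** (any compact `G`, any lattice representation `r`, any positive unit `a → 0`):
`FBL6 ∧ FC2 ∧ FC3` at `(r, a)` ⇒ `LowerBounds G r a ∧ MomentBounds6 G r a` — floors by the landed `stub_lower` (law of total covariance ∕
cumulance on one femto cube; `FBL` from `FBL6` by `fbl_of_fbl6`), ceilings by the landed `stub_collar6` (torus DLR collar).  No unit of
record, no window, no commensurability. -/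
theorem legs_of_cfp6 (r : LatticeRep G) {a : ℝ → ℝ} (ha : ∀ β, 0 < a β) (ha0 : Tendsto a atTop (𝓝 0)) (hFBL6 : FBL6 G r a)
    (hFC2 : FC2 G r a) (hFC3 : FC3 G r a) : LowerBounds G r a ∧ MomentBounds6 G r a :=
  ⟨stub_lower G r a ha ha0 (fbl_of_fbl6 r a hFBL6) hFC2 hFC3, stub_collar6 G r a hFBL6⟩

/-- **The legs witness from the CFP6 package** at its own unit: witness `(r, a)`. -/
theorem legsWitness_of_cfp6 (r : LatticeRep G) {a : ℝ → ℝ} (ha : ∀ β, 0 < a β) (ha0 : Tendsto a atTop (𝓝 0)) (hFBL6 : FBL6 G r a)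
    (hFC2 : FC2 G r a) (hFC3 : FC3 G r a) :
    ∃ (r : LatticeRep G) (a : ℝ → ℝ), (∀ β, 0 < a β) ∧ Tendsto a atTop (𝓝 0) ∧ LowerBounds G r a ∧ MomentBounds6 G r a :=
  ⟨r, a, ha, ha0, legs_of_cfp6 r ha ha0 hFBL6 hFC2 hFC3⟩

/-- **Both legs from ceilings-grade data at a FINER unit and the engine at its own unit**: the plane-resolved boundary law `FBL6` at a
unit `u` with `u ≤ c · a` eventually (intended: Bałaban's own unit of the flow of record, E0′) moves to the coarser engine unit `a`
(`CeilingsTransfer.fbl6_of_eventually_le`), where the engine's `FC2 ∧ FC3` live; then `legs_of_cfp6`.  One-sided comparability suffices. -/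
theorem legs_of_ceilings6_engine (r : LatticeRep G) {a u : ℝ → ℝ} {c : ℝ} (ha : ∀ β, 0 < a β) (ha0 : Tendsto a atTop (𝓝 0))
    (hc : 0 < c) (hle : ∀ᶠ β in atTop, u β ≤ c * a β) (hFBL6 : FBL6 G r u) (hFC2 : FC2 G r a) (hFC3 : FC3 G r a) :
    LowerBounds G r a ∧ MomentBounds6 G r a :=
  legs_of_cfp6 r ha ha0 (Summit.QuantumFields.YangMills.Cruxes.UVSeamRec.CeilingsTransfer.fbl6_of_eventually_le r hc hle hFBL6) hFC2 hFC3

/-- **Both legs from the femto packages through the engine-grade stub** `Statement.stub_fcp6` of crux stmt-QuantumFields-9367 (OPEN):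
for a compact simple `G`, `TwoPointPinned G r a ∧ Skewness G r a` ⇒ (`stub_fcp6`) `FBL6 ∧ FC2 ∧ FC3` at `(r, a)` ⇒ legs at `(r, a)`; the unit
is positive and `→ 0` by `TwoPointPinned`'s own clauses. -/
theorem legs_of_femto6 (hG : IsCompactSimpleLieGroup G) (hfcp : Statement.stub_fcp6) (r : LatticeRep G) {a : ℝ → ℝ}
    (hTP : TwoPointPinned G r a) (hSk : Skewness G r a) : LowerBounds G r a ∧ MomentBounds6 G r a := by
  obtain ⟨h6, h2, h3⟩ := hfcp G hG r a hTP hSk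
  obtain ⟨-, -, -, -, -, -, -, ha, ha0, -⟩ := hTP
  exact legs_of_cfp6 r ha ha0 h6 h2 h3

/-- Witness form of `legs_of_femto6`. -/
theorem legsWitness_of_femto6 (hG : IsCompactSimpleLieGroup G) (hfcp : Statement.stub_fcp6) (r : LatticeRep G) {a : ℝ → ℝ}
    (hTP : TwoPointPinned G r a) (hSk : Skewness G r a) :
    ∃ (r : LatticeRep G) (a : ℝ → ℝ), (∀ β, 0 < a β) ∧ Tendsto a atTop (𝓝 0) ∧ LowerBounds G r a ∧ MomentBounds6 G r a := by
  obtain ⟨hlb, hmb⟩ := legs_of_femto6 hG hfcp r hTP hSk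
  obtain ⟨-, -, -, -, -, -, -, ha, ha0, -⟩ := hTP
  exact ⟨r, a, ha, ha0, hlb, hmb⟩

end Generic

/-! ## §2 The `SU(N ≥ 3)` piece `UVSeamWitnessSUN` -/

/-- **`UVSeamWitnessSUN` from the CFP6 package at `SU(N)` in some representation and some unit** (per `N ≥ 3`, under the apex key
`UVD59 N`): the witness is the package's own `(r, a)` (`legsWitness_of_cfp6`); the tree's Borel instances on `SU(N)` are `borel _` ∕ `⟨rfl⟩`. -/
theorem uvSeamWitnessSUN_of_cfp6
    (h : ∀ (N : ℕ) [NeZero N], 3 ≤ N → YMDAG.UVSplit.UVD59 N →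
      ∃ (r : LatticeRep (Matrix.specialUnitaryGroup (Fin N) ℂ)) (a : ℝ → ℝ), (∀ β, 0 < a β) ∧ Tendsto a atTop (𝓝 0) ∧
        FBL6 (Matrix.specialUnitaryGroup (Fin N) ℂ) r a ∧ FC2 (Matrix.specialUnitaryGroup (Fin N) ℂ) r a ∧
        FC3 (Matrix.specialUnitaryGroup (Fin N) ℂ) r a) :
    UVSeamWitnessSUN := by
  intro N _ hN hD
  obtain ⟨r, a, ha, ha0, h6, h2, h3⟩ := h N hN hD
  exact legsWitness_of_cfp6 r ha ha0 h6 h2 h3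

/-- **`UVSeamWitnessSUN` at v4-F resolution, FUNDAMENTAL representation** (the `SU(N)` twin of the `UVSeamRec` skeleton's cut, in femto
currency): per `N ≥ 3`, under the apex key, (E0′) the plane-resolved boundary law `FBL6` for the fundamental representation
`fundamentalLatticeRep N` (the representation of Bałaban's Wilson action) at SOME unit `u` — intended Bałaban's own — and (engine) `FC2 ∧ FC3`
for the same representation at a positive unit `a → 0` with `u ≤ c · a` eventually ⇒ the witness `(fundamentalLatticeRep N, a)`.  Neither a
unit of record nor two-sided commensurability is needed. -/
theorem uvSeamWitnessSUN_of_ceilings6_engine_fundamental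
    (h : ∀ (N : ℕ) [NeZero N], 3 ≤ N → YMDAG.UVSplit.UVD59 N →
      ∃ (u a : ℝ → ℝ) (c : ℝ), FBL6 (Matrix.specialUnitaryGroup (Fin N) ℂ) (fundamentalLatticeRep N) u ∧ 0 < c ∧
        (∀ᶠ β in atTop, u β ≤ c * a β) ∧ (∀ β, 0 < a β) ∧ Tendsto a atTop (𝓝 0) ∧
        FC2 (Matrix.specialUnitaryGroup (Fin N) ℂ) (fundamentalLatticeRep N) a ∧
        FC3 (Matrix.specialUnitaryGroup (Fin N) ℂ) (fundamentalLatticeRep N) a) :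
    UVSeamWitnessSUN := by
  intro N _ hN hD
  obtain ⟨u, a, c, h6, hc, hle, ha, ha0, h2, h3⟩ := h N hN hD
  exact ⟨fundamentalLatticeRep N, a, ha, ha0, legs_of_ceilings6_engine (fundamentalLatticeRep N) ha ha0 hc hle h6 h2 h3⟩

/-- **`UVSeamWitnessSUN` from the femto packages through `Statement.stub_fcp6`** (OPEN engine stub of crux 9367): per `N ≥ 3`, under
the apex key, SOME representation of `SU(N)` and SOME unit carry `TwoPointPinned ∧ Skewness` ⇒ the witness (`SU(N)` is a compact simple
Lie group unconditionally, `isSimpleCompactGroup_specialUnitaryGroup_holds`). -/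
theorem uvSeamWitnessSUN_of_femto6 (hfcp : Statement.stub_fcp6)
    (h : ∀ (N : ℕ) [NeZero N], 3 ≤ N → YMDAG.UVSplit.UVD59 N →
      ∃ (r : LatticeRep (Matrix.specialUnitaryGroup (Fin N) ℂ)) (a : ℝ → ℝ),
        TwoPointPinned (Matrix.specialUnitaryGroup (Fin N) ℂ) r a ∧ Skewness (Matrix.specialUnitaryGroup (Fin N) ℂ) r a) :
    UVSeamWitnessSUN := by
  intro N _ hN hD
  obtain ⟨r, a, hTP, hSk⟩ := h N hN hD
  exact legsWitness_of_femto6 (isCompactSimpleLieGroup_specialUnitaryGroup isSimpleCompactGroup_specialUnitaryGroup_holds (by omega))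
    hfcp r hTP hSk

/-! ## §3 The non-`SU(N)` record piece -/

/-- **The non-`SU(N)` record residual from the CFP6 package** (per group, some representation, some unit): for every compact simple `G`
admitting no `G ≃ₜ* SU(N)` (`N ≥ 2`), `FBL6 ∧ FC2 ∧ FC3` at some `(r, a)` ⇒ the record residual (stated inline; the decl name is the route
owner's, `UVNonSUNRec` in `R85_closes_preview.lean`). -/
theorem nonSUNRec_of_cfp6
    (h : ∀ (G : Type) [Group G] [TopologicalSpace G] [IsTopologicalGroup G] [CompactSpace G],
      IsCompactSimpleLieGroup G → (∀ N : ℕ, 2 ≤ N → IsEmpty (G ≃ₜ* Matrix.specialUnitaryGroup (Fin N) ℂ)) →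
      letI : MeasurableSpace G := borel G; haveI : BorelSpace G := ⟨rfl⟩;
      ∃ (r : LatticeRep G) (a : ℝ → ℝ), (∀ β, 0 < a β) ∧ Tendsto a atTop (𝓝 0) ∧ FBL6 G r a ∧ FC2 G r a ∧ FC3 G r a) :
    ∀ (G : Type) [Group G] [TopologicalSpace G] [IsTopologicalGroup G] [CompactSpace G],
      IsCompactSimpleLieGroup G → (∀ N : ℕ, 2 ≤ N → IsEmpty (G ≃ₜ* Matrix.specialUnitaryGroup (Fin N) ℂ)) →
      letI : MeasurableSpace G := borel G; haveI : BorelSpace G := ⟨rfl⟩;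
      ∃ (r : LatticeRep G) (a : ℝ → ℝ), (∀ β, 0 < a β) ∧ Tendsto a atTop (𝓝 0) ∧ LowerBounds G r a ∧ MomentBounds6 G r a := by
  intro G _ _ _ _ hG hno
  letI : MeasurableSpace G := borel G
  haveI : BorelSpace G := ⟨rfl⟩
  obtain ⟨r, a, ha, ha0, h6, h2, h3⟩ := h G hG hno
  exact legsWitness_of_cfp6 r ha ha0 h6 h2 h3

/-- **The non-`SU(N)` record residual from the femto packages through `Statement.stub_fcp6`**. -/
theorem nonSUNRec_of_femto6 (hfcp : Statement.stub_fcp6)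
    (h : ∀ (G : Type) [Group G] [TopologicalSpace G] [IsTopologicalGroup G] [CompactSpace G],
      IsCompactSimpleLieGroup G → (∀ N : ℕ, 2 ≤ N → IsEmpty (G ≃ₜ* Matrix.specialUnitaryGroup (Fin N) ℂ)) →
      letI : MeasurableSpace G := borel G; haveI : BorelSpace G := ⟨rfl⟩;
      ∃ (r : LatticeRep G) (a : ℝ → ℝ), TwoPointPinned G r a ∧ Skewness G r a) :
    ∀ (G : Type) [Group G] [TopologicalSpace G] [IsTopologicalGroup G] [CompactSpace G],
      IsCompactSimpleLieGroup G → (∀ N : ℕ, 2 ≤ N → IsEmpty (G ≃ₜ* Matrix.specialUnitaryGroup (Fin N) ℂ)) →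
      letI : MeasurableSpace G := borel G; haveI : BorelSpace G := ⟨rfl⟩;
      ∃ (r : LatticeRep G) (a : ℝ → ℝ), (∀ β, 0 < a β) ∧ Tendsto a atTop (𝓝 0) ∧ LowerBounds G r a ∧ MomentBounds6 G r a := by
  intro G _ _ _ _ hG hno
  letI : MeasurableSpace G := borel G
  haveI : BorelSpace G := ⟨rfl⟩
  obtain ⟨r, a, hTP, hSk⟩ := h G hG hno
  exact legsWitness_of_femto6 hG hfcp r hTP hSk

/-! ## §4 All groups: the bridge's UV-side input from the femto package -/

/-- **The all-groups legs witness from the CFP6 package per group** (some representation, some unit, per compact simple `G`). -/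
theorem legsWitnessAll_of_cfp6All
    (h : ∀ (G : Type) [Group G] [TopologicalSpace G] [IsTopologicalGroup G] [CompactSpace G],
      IsCompactSimpleLieGroup G → letI : MeasurableSpace G := borel G; haveI : BorelSpace G := ⟨rfl⟩;
      ∃ (r : LatticeRep G) (a : ℝ → ℝ), (∀ β, 0 < a β) ∧ Tendsto a atTop (𝓝 0) ∧ FBL6 G r a ∧ FC2 G r a ∧ FC3 G r a) :
    ∀ (G : Type) [Group G] [TopologicalSpace G] [IsTopologicalGroup G] [CompactSpace G],
      IsCompactSimpleLieGroup G → letI : MeasurableSpace G := borel G; haveI : BorelSpace G := ⟨rfl⟩;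
      ∃ (r : LatticeRep G) (a : ℝ → ℝ), (∀ β, 0 < a β) ∧ Tendsto a atTop (𝓝 0) ∧ LowerBounds G r a ∧ MomentBounds6 G r a := by
  intro G _ _ _ _ hG
  letI : MeasurableSpace G := borel G
  haveI : BorelSpace G := ⟨rfl⟩
  obtain ⟨r, a, ha, ha0, h6, h2, h3⟩ := h G hG
  exact legsWitness_of_cfp6 r ha ha0 h6 h2 h3

/-- **The all-groups legs witness from the femto packages through `Statement.stub_fcp6`** (crux 9367's engine stub, OPEN). -/
theorem legsWitnessAll_of_femto6All (hfcp : Statement.stub_fcp6)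
    (h : ∀ (G : Type) [Group G] [TopologicalSpace G] [IsTopologicalGroup G] [CompactSpace G],
      IsCompactSimpleLieGroup G → letI : MeasurableSpace G := borel G; haveI : BorelSpace G := ⟨rfl⟩;
      ∃ (r : LatticeRep G) (a : ℝ → ℝ), TwoPointPinned G r a ∧ Skewness G r a) :
    ∀ (G : Type) [Group G] [TopologicalSpace G] [IsTopologicalGroup G] [CompactSpace G],
      IsCompactSimpleLieGroup G → letI : MeasurableSpace G := borel G; haveI : BorelSpace G := ⟨rfl⟩;
      ∃ (r : LatticeRep G) (a : ℝ → ℝ), (∀ β, 0 < a β) ∧ Tendsto a atTop (𝓝 0) ∧ LowerBounds G r a ∧ MomentBounds6 G r a := by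
  intro G _ _ _ _ hG
  letI : MeasurableSpace G := borel G
  haveI : BorelSpace G := ⟨rfl⟩
  obtain ⟨r, a, hTP, hSk⟩ := h G hG
  exact legsWitness_of_femto6 hG hfcp r hTP hSk

/-- **The bridge fed by the femto package** (identity check with the apex feed `yangMills_of_recordSplit_rotIR`: both land in the same input of
`Y2Bridge.yangMills_of_legs`): the CFP6 package at some `(r, a)` for every compact simple `G`, the spine's `IR`, and `ROT` rev 2 (infrared
guard) ⊢ `YangMills`.  Conditional on all three hypotheses, the first XL per group; nothing is discharged; not a route. -/
theorem yangMills_of_cfp6All_rotIR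
    (h : ∀ (G : Type) [Group G] [TopologicalSpace G] [IsTopologicalGroup G] [CompactSpace G],
      IsCompactSimpleLieGroup G → letI : MeasurableSpace G := borel G; haveI : BorelSpace G := ⟨rfl⟩;
      ∃ (r : LatticeRep G) (a : ℝ → ℝ), (∀ β, 0 < a β) ∧ Tendsto a atTop (𝓝 0) ∧ FBL6 G r a ∧ FC2 G r a ∧ FC3 G r a)
    (hIR : Summit.QuantumFields.YangMills.Theses.BalabanLadder.IR)
    (hROT : ∀ (G : Type) [Group G] [TopologicalSpace G] [IsTopologicalGroup G] [CompactSpace G],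
      IsCompactSimpleLieGroup G → letI : MeasurableSpace G := borel G; haveI : BorelSpace G := ⟨rfl⟩;
      ∀ (r : LatticeRep G) (a : ℝ → ℝ), (∀ β, 0 < a β) → Tendsto a atTop (𝓝 0) →
        LowerBounds G r a → MomentBounds6 G r a → GapInUnits G r a → LatticeRotWard G r a) :
    YangMills := by
  refine yangMills_of_legs ?_
  intro G _ _ _ _ hG
  letI : MeasurableSpace G := borel G
  haveI : BorelSpace G := ⟨rfl⟩
  obtain ⟨r, a, ha, ha0, hlb, hmb⟩ := legsWitnessAll_of_cfp6All h G hG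
  have hir := hIR G hG r a ha ha0 hlb
  exact ⟨r, a, ha, ha0, hmb, hlb, hir, hROT G hG r a ha ha0 hlb hmb hir⟩

end Summit.QuantumFields.YangMills.Theorems.UVOtherGroups

end
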